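import Summits.ResolutionOfSingularities.ResolutionOfSingularities.Theorems.FrobeniusLadderFInjectiveMacaulayficationLx6q7Specimen
import Summits.ResolutionOfSingularities.ResolutionOfSingularities.Theorems.FrobeniusLadderFInjectiveMacaulayficationTauFloorInputNotFull
import Summits.ResolutionOfSingularities.ResolutionOfSingularities.Theorems.FrobeniusLadderFInjectiveMacaulayficationStrictTransformChartN
import Summits.ResolutionOfSingularities.ResolutionOfSingularities.Theorems.FrobeniusLadderFInjectiveMacaulayficationPrimeTransfer
import Summits.ResolutionOfSingularities.ResolutionOfSingularities.Theorems.FrobeniusLadderFInjectiveMacaulayficationHypersurfaceOriginNotFull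
import HarnessLib

/-!
# (O-2) The POINT floor of d4lx6q7: the five charts of `Bl_𝔪 X` are hypersurfaces — CM at every prime; the origin of `D(x)` is NOT FULL
# (crux `FInjectiveMacaulayfication` stmt-ResolutionOfSingularities-15315, chain w45a; res-L1-w45a-plan-1 g19 RULING R19.14 «(O-2) the K-TT-a FLOOR PACKAGE for
# d4lx6q7»; seat res-L1-w45a-stub-3 g10; floor-1 table cross-checked against res-L1-w45a-idea-1 FB5-r7 `cert/lineage-d4lx6q7.json`)

[OURS · L1 W4.5a] Support file (`--supports stmt-ResolutionOfSingularities-15315 --as helper`); def-free, unconditional; replaces the role of NO printed item;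
NOT a statement of the manuscript; AI-written (AI review is weaker than expert review).

`X = Spec A₀`, `A₀ = k[X0..X4]/(f)`, `f = X4² + X0⁶X4 + X1³ + X2³ + X3⁷` (`x,y,u,t,z`), `char k = 2`, `𝔪 = (x̄, ȳ, ū, t̄, z̄)` = the vertex `v`. The point blow-up
`Bl_𝔪 X = affineBlowup 𝔪` is covered by the five Rees charts `D(x̄ᵢt)`, whose rings are the STRICT TRANSFORMS `k[X]/(gᵢ)`, `θᵢ f = Xᵢ²·gᵢ`
(`StrictTransformChartN.stub_strictTransformChartN`):
`g_x = z² + x⁵z + x(y³+u³) + x⁵t⁷`, `g_y = z² + x⁶y⁵z + y(1+u³) + y⁵t⁷`, `g_u = z² + x⁶u⁵z + u(1+y³) + u⁵t⁷`, `g_t = z² + x⁶t⁵z + t(y³+u³) + t⁵`,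
`g_z = 1 + x⁶z⁵ + z(y³+u³) + z⁵t⁷` (variables renamed back; idea-1's floor-1 table).
* §1 `theta`, `f_not_mem_span_X`, `g_not_mem_span_X`, `isPrime_span_g` (prime transfer, `PrimeTransfer.stub_primeTransfer`);
* §2 ★ `cmCl_reesChart` — every Rees chart of `Bl_𝔪 X` is CM at EVERY prime (hypersurfaces: `DoublePointFermatCubicGerm.cmCl_localization_hypersurface`);
  ★ `cmCl_stalk_affineBlowup` — `Bl_𝔪 X` satisfies the CM clause at every point;
* §3 ★★ `exists_point_over_vertex_not_fullCl` — a point of `Bl_𝔪 X` over `v` whose stalk is NOT FULL: the ORIGIN of the chart `D(x̄)`, by Fedder necessity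
  (`g_x ∈ (X0², …, X4²)`, `HypersurfaceOriginNotFull.not_fullCl_stalk_origin_of_fedder_mem`) — idea-1: «the floor-1 origin of D(x) is non-F-pure».
[folklore mathematics, OURS as a certificate; cite: Fedder1983, Prop. 1.7; StacksProject, Tag 0804; Kollar2007, §2.5 (strict transforms under point blow-ups)]
-/

-- single-problem summit: the doubled namespace component is forced
set_option linter.dupNamespace false

noncomputable section

namespace Summit.ResolutionOfSingularities.ResolutionOfSingularities.Theorems.FInjectiveMacaulayfication.Lx6q7PointFloorCharts

open AlgebraicGeometry CategoryTheory Literature.AlgebraicGeometry.Resolution TopologicalSpace IsLocalRing MvPolynomial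
open Summit.ResolutionOfSingularities.ResolutionOfSingularities.Theorems.FInjectiveMacaulayfication
open SliceableCentre

variable (k : Type) [Field k]

/-! ## §1 The strict transforms -/

/-- ★ **The chart identities** `θᵢ f = Xᵢ² · gᵢ` for the point blow-up substitutions `θᵢ : Xⱼ ↦ XⱼXᵢ (j ≠ i), Xᵢ ↦ Xᵢ`. [folklore] -/
theorem theta (f : MvPolynomial (Fin 5) k) (hf : f = X 4 ^ 2 + X 0 ^ 6 * X 4 + X 1 ^ 3 + X 2 ^ 3 + X 3 ^ 7) :
    ∀ i : Fin 5, aeval (fun j : Fin 5 => if j = i then (X i : MvPolynomial (Fin 5) k) else X j * X i) f =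
      X i ^ 2 * (![X 4 ^ 2 + X 0 ^ 5 * X 4 + X 0 * X 1 ^ 3 + X 0 * X 2 ^ 3 + X 0 ^ 5 * X 3 ^ 7,
        X 4 ^ 2 + X 0 ^ 6 * X 1 ^ 5 * X 4 + X 1 + X 1 * X 2 ^ 3 + X 1 ^ 5 * X 3 ^ 7,
        X 4 ^ 2 + X 0 ^ 6 * X 2 ^ 5 * X 4 + X 2 * X 1 ^ 3 + X 2 + X 2 ^ 5 * X 3 ^ 7,
        X 4 ^ 2 + X 0 ^ 6 * X 3 ^ 5 * X 4 + X 3 * X 1 ^ 3 + X 3 * X 2 ^ 3 + X 3 ^ 5,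
        1 + X 0 ^ 6 * X 4 ^ 5 + X 4 * X 1 ^ 3 + X 4 * X 2 ^ 3 + X 3 ^ 7 * X 4 ^ 5] : Fin 5 → MvPolynomial (Fin 5) k) i := by
  intro i
  subst hf
  fin_cases i <;> simp <;> ring

/-- `f ∉ (Xᵢ)` for every `i`: evaluate at a point with `Xᵢ = 0` where `f = 1`. [folklore] -/
theorem f_not_mem_span_X (f : MvPolynomial (Fin 5) k) (hf : f = X 4 ^ 2 + X 0 ^ 6 * X 4 + X 1 ^ 3 + X 2 ^ 3 + X 3 ^ 7) :
    ∀ i : Fin 5, f ∉ Ideal.span {(X i : MvPolynomial (Fin 5) k)} := by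
  intro i h
  rw [Ideal.mem_span_singleton] at h
  obtain ⟨c, hc⟩ := h
  -- the point `e_1` (resp. `e_2` for `i = 1`) kills `Xᵢ` and gives `f = 1`
  by_cases hi : i = 1
  · subst hi
    have := congrArg (MvPolynomial.eval (Pi.single 2 1 : Fin 5 → k)) hc
    rw [hf] at this
    simp at this
  · have := congrArg (MvPolynomial.eval (Pi.single 1 1 : Fin 5 → k)) hc
    rw [hf] at this
    have h1 : (Pi.single 1 1 : Fin 5 → k) i = 0 := by rw [Pi.single_apply, if_neg hi]
    simp [h1] at this

/-- `gᵢ ∉ (Xᵢ)` for every `i`: evaluate at `e_4` (`gᵢ = 1` there, `i ≤ 3`) resp. at `0` (`g_z(0) = 1`). [folklore] -/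
theorem g_not_mem_span_X :
    ∀ i : Fin 5, (![X 4 ^ 2 + X 0 ^ 5 * X 4 + X 0 * X 1 ^ 3 + X 0 * X 2 ^ 3 + X 0 ^ 5 * X 3 ^ 7,
        X 4 ^ 2 + X 0 ^ 6 * X 1 ^ 5 * X 4 + X 1 + X 1 * X 2 ^ 3 + X 1 ^ 5 * X 3 ^ 7,
        X 4 ^ 2 + X 0 ^ 6 * X 2 ^ 5 * X 4 + X 2 * X 1 ^ 3 + X 2 + X 2 ^ 5 * X 3 ^ 7,
        X 4 ^ 2 + X 0 ^ 6 * X 3 ^ 5 * X 4 + X 3 * X 1 ^ 3 + X 3 * X 2 ^ 3 + X 3 ^ 5,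
        1 + X 0 ^ 6 * X 4 ^ 5 + X 4 * X 1 ^ 3 + X 4 * X 2 ^ 3 + X 3 ^ 7 * X 4 ^ 5] : Fin 5 → MvPolynomial (Fin 5) k) i ∉ Ideal.span {(X i : MvPolynomial (Fin 5) k)} := by
  intro i h
  rw [Ideal.mem_span_singleton] at h
  obtain ⟨c, hc⟩ := h
  fin_cases i
  · have := congrArg (MvPolynomial.eval (Pi.single 4 1 : Fin 5 → k)) hc; simp at this
  · have := congrArg (MvPolynomial.eval (Pi.single 4 1 : Fin 5 → k)) hc; simp at this
  · have := congrArg (MvPolynomial.eval (Pi.single 4 1 : Fin 5 → k)) hc; simp at this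
  · have := congrArg (MvPolynomial.eval (Pi.single 4 1 : Fin 5 → k)) hc; simp at this
  · have := congrArg (MvPolynomial.eval (0 : Fin 5 → k)) hc; simp at this

/-- `gᵢ ≠ 0`. [plumbing] -/
theorem g_ne_zero (i : Fin 5) : (![X 4 ^ 2 + X 0 ^ 5 * X 4 + X 0 * X 1 ^ 3 + X 0 * X 2 ^ 3 + X 0 ^ 5 * X 3 ^ 7,
        X 4 ^ 2 + X 0 ^ 6 * X 1 ^ 5 * X 4 + X 1 + X 1 * X 2 ^ 3 + X 1 ^ 5 * X 3 ^ 7,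
        X 4 ^ 2 + X 0 ^ 6 * X 2 ^ 5 * X 4 + X 2 * X 1 ^ 3 + X 2 + X 2 ^ 5 * X 3 ^ 7,
        X 4 ^ 2 + X 0 ^ 6 * X 3 ^ 5 * X 4 + X 3 * X 1 ^ 3 + X 3 * X 2 ^ 3 + X 3 ^ 5,
        1 + X 0 ^ 6 * X 4 ^ 5 + X 4 * X 1 ^ 3 + X 4 * X 2 ^ 3 + X 3 ^ 7 * X 4 ^ 5] : Fin 5 → MvPolynomial (Fin 5) k) i ≠ 0 := fun h =>
  g_not_mem_span_X k i (h ▸ Ideal.zero_mem _)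

/-- `(gᵢ)` is prime (prime transfer along `θᵢ` from `(f)` prime). [folklore; `PrimeTransfer.stub_primeTransfer`] -/
theorem isPrime_span_g [CharP k 2] (f : MvPolynomial (Fin 5) k) (hf : f = X 4 ^ 2 + X 0 ^ 6 * X 4 + X 1 ^ 3 + X 2 ^ 3 + X 3 ^ 7) (i : Fin 5) :
    (Ideal.span {(![X 4 ^ 2 + X 0 ^ 5 * X 4 + X 0 * X 1 ^ 3 + X 0 * X 2 ^ 3 + X 0 ^ 5 * X 3 ^ 7,
        X 4 ^ 2 + X 0 ^ 6 * X 1 ^ 5 * X 4 + X 1 + X 1 * X 2 ^ 3 + X 1 ^ 5 * X 3 ^ 7,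
        X 4 ^ 2 + X 0 ^ 6 * X 2 ^ 5 * X 4 + X 2 * X 1 ^ 3 + X 2 + X 2 ^ 5 * X 3 ^ 7,
        X 4 ^ 2 + X 0 ^ 6 * X 3 ^ 5 * X 4 + X 3 * X 1 ^ 3 + X 3 * X 2 ^ 3 + X 3 ^ 5,
        1 + X 0 ^ 6 * X 4 ^ 5 + X 4 * X 1 ^ 3 + X 4 * X 2 ^ 3 + X 3 ^ 7 * X 4 ^ 5] : Fin 5 → MvPolynomial (Fin 5) k) i}).IsPrime := by
  have hfprime : (Ideal.span {f}).IsPrime := (Ideal.span_singleton_prime (Lx6q7Specimen.prime_f k f hf).ne_zero).mpr (Lx6q7Specimen.prime_f k f hf)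
  exact (PrimeTransfer.stub_primeTransfer k 5 i f _ 2 (theta k f hf i) (f_not_mem_span_X k f hf i) (g_not_mem_span_X k i)).mp hfprime

/-! ## §2 CM at every prime of every chart, hence at every stalk of `Bl_𝔪 X` -/

set_option maxHeartbeats 800000 in
-- chart-ring types are expensive to unify (as in `StrictTransformChartN`)
/-- ★ **Every Rees chart `D(x̄ᵢt)` of `Bl_𝔪 X` is CM at EVERY prime**: it is the hypersurface ring `k[X]/(gᵢ)` (`stub_strictTransformChartN`), and hypersurfaces in
regular rings are CM. [cite: Matsumura1987, Thm. 17.4 (iii), Thm. 17.8] -/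
theorem cmCl_reesChart [CharP k 2] (f : MvPolynomial (Fin 5) k) (hf : f = X 4 ^ 2 + X 0 ^ 6 * X 4 + X 1 ^ 3 + X 2 ^ 3 + X 3 ^ 7) (i : Fin 5)
    (q : Ideal (HomogeneousLocalization.Away (reesGrading (Ideal.span (Set.range (fun j : Fin 5 => Ideal.Quotient.mk (Ideal.span {f}) (X j)))))
      (reesT ((fun j : Fin 5 => Ideal.Quotient.mk (Ideal.span {f}) (X j)) i) (Ideal.subset_span (Set.mem_range_self i))))) [q.IsPrime] :
    CMCl (Localization.AtPrime q) := by
  have hfprime : (Ideal.span {f}).IsPrime := (Ideal.span_singleton_prime (Lx6q7Specimen.prime_f k f hf).ne_zero).mpr (Lx6q7Specimen.prime_f k f hf)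
  obtain ⟨e, -⟩ := StrictTransformChartN.stub_strictTransformChartN k 5 f _ i 2 hfprime (Lx6q7Specimen.prime_f k f hf).ne_zero
    (isPrime_span_g k f hf i) (PrimeTransfer.X_not_mem_span_of_isPrime (isPrime_span_g k f hf i) (g_not_mem_span_X k i)) (theta k f hf i) (fun j : Fin 5 => Ideal.Quotient.mk (Ideal.span {f}) (X j)) rfl
  exact ReesChartFacts.transport_cmCl e (fun Q _ => DoublePointFermatCubicGerm.cmCl_localization_hypersurface k _ (g_ne_zero k i) ⟨Q, inferInstance⟩) q

/-- ★ **`Bl_𝔪 X = affineBlowup 𝔪` satisfies the CM clause at EVERY point.** [folklore assembly; cite: StacksProject, Tag 0804] -/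
theorem cmCl_stalk_affineBlowup [CharP k 2] (f : MvPolynomial (Fin 5) k) (hf : f = X 4 ^ 2 + X 0 ^ 6 * X 4 + X 1 ^ 3 + X 2 ^ 3 + X 3 ^ 7)
    (y : ↥(affineBlowup (Ideal.span (Set.range (fun j : Fin 5 => Ideal.Quotient.mk (Ideal.span {f}) (X j)))))) :
    CMCl ((affineBlowup (Ideal.span (Set.range (fun j : Fin 5 => Ideal.Quotient.mk (Ideal.span {f}) (X j))))).presheaf.stalk y) :=
  TauFloorInputLegal.cmCl_stalk_affineBlowup_of_charts (fun j : Fin 5 => Ideal.Quotient.mk (Ideal.span {f}) (X j)) (fun i _ q _ => cmCl_reesChart k f hf i q) y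

/-! ## §3 The origin of the chart `D(x̄)` is NOT FULL -/

/-- `g_x ∈ 𝔫^{[2]} = (X0², …, X4²)` (every monomial of `g_x` is divisible by the square of a variable). [certificate; cite: Fedder1983, Prop. 1.7] -/
theorem g_zero_mem_bracket :
    ((![X 4 ^ 2 + X 0 ^ 5 * X 4 + X 0 * X 1 ^ 3 + X 0 * X 2 ^ 3 + X 0 ^ 5 * X 3 ^ 7,
        X 4 ^ 2 + X 0 ^ 6 * X 1 ^ 5 * X 4 + X 1 + X 1 * X 2 ^ 3 + X 1 ^ 5 * X 3 ^ 7,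
        X 4 ^ 2 + X 0 ^ 6 * X 2 ^ 5 * X 4 + X 2 * X 1 ^ 3 + X 2 + X 2 ^ 5 * X 3 ^ 7,
        X 4 ^ 2 + X 0 ^ 6 * X 3 ^ 5 * X 4 + X 3 * X 1 ^ 3 + X 3 * X 2 ^ 3 + X 3 ^ 5,
        1 + X 0 ^ 6 * X 4 ^ 5 + X 4 * X 1 ^ 3 + X 4 * X 2 ^ 3 + X 3 ^ 7 * X 4 ^ 5] : Fin 5 → MvPolynomial (Fin 5) k) 0) ^ (2 - 1) ∈ Ideal.span (Set.range fun i : Fin 5 => (X i : MvPolynomial (Fin 5) k) ^ 2) := by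
  rw [show (2 - 1 : ℕ) = 1 from rfl, pow_one]
  have hsq : ∀ j : Fin 5, (X j : MvPolynomial (Fin 5) k) ^ 2 ∈ Ideal.span (Set.range fun i : Fin 5 => (X i : MvPolynomial (Fin 5) k) ^ 2) :=
    fun j => Ideal.subset_span ⟨j, rfl⟩
  change (X 4 ^ 2 + X 0 ^ 5 * X 4 + X 0 * X 1 ^ 3 + X 0 * X 2 ^ 3 + X 0 ^ 5 * X 3 ^ 7 : MvPolynomial (Fin 5) k) ∈ _
  refine Ideal.add_mem _ (Ideal.add_mem _ (Ideal.add_mem _ (Ideal.add_mem _ (hsq 4) ?_) ?_) ?_) ?_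
  · rw [show (X 0 : MvPolynomial (Fin 5) k) ^ 5 * X 4 = X 0 ^ 2 * (X 0 ^ 3 * X 4) by ring]
    exact Ideal.mul_mem_right _ _ (hsq 0)
  · rw [show (X 0 : MvPolynomial (Fin 5) k) * X 1 ^ 3 = X 1 ^ 2 * (X 0 * X 1) by ring]
    exact Ideal.mul_mem_right _ _ (hsq 1)
  · rw [show (X 0 : MvPolynomial (Fin 5) k) * X 2 ^ 3 = X 2 ^ 2 * (X 0 * X 2) by ring]
    exact Ideal.mul_mem_right _ _ (hsq 2)
  · rw [show (X 0 : MvPolynomial (Fin 5) k) ^ 5 * X 3 ^ 7 = X 0 ^ 2 * (X 0 ^ 3 * X 3 ^ 7) by ring]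
    exact Ideal.mul_mem_right _ _ (hsq 0)

/-- `g_x` has no constant term. [plumbing] -/
theorem constantCoeff_g_zero : constantCoeff ((![X 4 ^ 2 + X 0 ^ 5 * X 4 + X 0 * X 1 ^ 3 + X 0 * X 2 ^ 3 + X 0 ^ 5 * X 3 ^ 7,
        X 4 ^ 2 + X 0 ^ 6 * X 1 ^ 5 * X 4 + X 1 + X 1 * X 2 ^ 3 + X 1 ^ 5 * X 3 ^ 7,
        X 4 ^ 2 + X 0 ^ 6 * X 2 ^ 5 * X 4 + X 2 * X 1 ^ 3 + X 2 + X 2 ^ 5 * X 3 ^ 7,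
        X 4 ^ 2 + X 0 ^ 6 * X 3 ^ 5 * X 4 + X 3 * X 1 ^ 3 + X 3 * X 2 ^ 3 + X 3 ^ 5,
        1 + X 0 ^ 6 * X 4 ^ 5 + X 4 * X 1 ^ 3 + X 4 * X 2 ^ 3 + X 3 ^ 7 * X 4 ^ 5] : Fin 5 → MvPolynomial (Fin 5) k) 0) = 0 := by
  simp [constantCoeff_X]

set_option synthInstance.maxHeartbeats 200000 in
set_option maxHeartbeats 1600000 in
-- two ring equivalences onto the blow-up algebra + one localization transport
/-- ★★ **A point of `Bl_𝔪 X` over the vertex with a NON-FULL stalk**: the origin of the chart `D(x̄)` — `k[X]/(g_x)` is not FULL at its origin by Fedder necessity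
(`g_x ∈ 𝔫^{[2]}`); transported along `k[X]/(g_x) ≃ (A₀[𝔪t])_{(x̄t)} ≃ A₀[𝔪/x̄]` (`stub_strictTransformChartN`, `ReesChartFacts`) and placed on `Bl_𝔪 X` by
`TauFloorInputNotFull.exists_point_over_centre_not_fullCl` (res-L1-w45a-stub-1). [OURS · certificate; cite: Fedder1983, Prop. 1.7] -/
theorem exists_point_over_vertex_not_fullCl [CharP k 2] (f : MvPolynomial (Fin 5) k) (hf : f = X 4 ^ 2 + X 0 ^ 6 * X 4 + X 1 ^ 3 + X 2 ^ 3 + X 3 ^ 7)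
    (v : Spec (.of (MvPolynomial (Fin 5) k ⧸ Ideal.span {f}))) (hv : v.asIdeal = Ideal.span (Set.range (fun j : Fin 5 => Ideal.Quotient.mk (Ideal.span {f}) (X j)))) :
    ∃ b : ↥(affineBlowup (Ideal.span (Set.range (fun j : Fin 5 => Ideal.Quotient.mk (Ideal.span {f}) (X j))))),
      (affineBlowup.π _).base b = v ∧ ¬ FullCl 2 ((affineBlowup (Ideal.span (Set.range (fun j : Fin 5 => Ideal.Quotient.mk (Ideal.span {f}) (X j))))).presheaf.stalk b) := by
  classical
  haveI : Fact (Nat.Prime 2) := ⟨Nat.prime_two⟩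
  have hfprime : (Ideal.span {f}).IsPrime := (Ideal.span_singleton_prime (Lx6q7Specimen.prime_f k f hf).ne_zero).mpr (Lx6q7Specimen.prime_f k f hf)
  -- the chart ring `k[X]/(g_x)` and its identification with `A₀[𝔪/x̄]`
  obtain ⟨e₀, he₀⟩ := StrictTransformChartN.stub_strictTransformChartN k 5 f _ 0 2 hfprime (Lx6q7Specimen.prime_f k f hf).ne_zero
    (isPrime_span_g k f hf 0) (PrimeTransfer.X_not_mem_span_of_isPrime (isPrime_span_g k f hf 0) (g_not_mem_span_X k 0)) (theta k f hf 0) (fun j : Fin 5 => Ideal.Quotient.mk (Ideal.span {f}) (X j)) rfl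
  have hx0 : Ideal.Quotient.mk (Ideal.span {f}) (X 0) ∈ Ideal.span (Set.range (fun j : Fin 5 => Ideal.Quotient.mk (Ideal.span {f}) (X j))) := Ideal.subset_span ⟨0, rfl⟩
  obtain ⟨e, he⟩ := ReesChartFacts.exists_reesChartEquiv (Ideal.span (Set.range (fun j : Fin 5 => Ideal.Quotient.mk (Ideal.span {f}) (X j)))) (Ideal.Quotient.mk (Ideal.span {f}) (X 0)) hx0
  let E := e₀.trans e
  have hE : E (Ideal.Quotient.mk _ (X 0)) = algebraMap (MvPolynomial (Fin 5) k ⧸ Ideal.span {f}) _ (Ideal.Quotient.mk (Ideal.span {f}) (X 0)) := by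
    change e (e₀ (Ideal.Quotient.mk _ (X 0))) = _
    rw [he₀, he]
  -- the origin of the chart, transported
  haveI hmax : (Ideal.span (Set.range fun j : Fin 5 => Ideal.Quotient.mk (Ideal.span {(![X 4 ^ 2 + X 0 ^ 5 * X 4 + X 0 * X 1 ^ 3 + X 0 * X 2 ^ 3 + X 0 ^ 5 * X 3 ^ 7,
        X 4 ^ 2 + X 0 ^ 6 * X 1 ^ 5 * X 4 + X 1 + X 1 * X 2 ^ 3 + X 1 ^ 5 * X 3 ^ 7,
        X 4 ^ 2 + X 0 ^ 6 * X 2 ^ 5 * X 4 + X 2 * X 1 ^ 3 + X 2 + X 2 ^ 5 * X 3 ^ 7,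
        X 4 ^ 2 + X 0 ^ 6 * X 3 ^ 5 * X 4 + X 3 * X 1 ^ 3 + X 3 * X 2 ^ 3 + X 3 ^ 5,
        1 + X 0 ^ 6 * X 4 ^ 5 + X 4 * X 1 ^ 3 + X 4 * X 2 ^ 3 + X 3 ^ 7 * X 4 ^ 5] : Fin 5 → MvPolynomial (Fin 5) k) 0}) (X j))).IsMaximal :=
    DoublePointFermatCubicGerm.isMaximal_origin k _ (constantCoeff_g_zero k)
  let Q := (Ideal.span (Set.range fun j : Fin 5 => Ideal.Quotient.mk (Ideal.span {(![X 4 ^ 2 + X 0 ^ 5 * X 4 + X 0 * X 1 ^ 3 + X 0 * X 2 ^ 3 + X 0 ^ 5 * X 3 ^ 7,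
        X 4 ^ 2 + X 0 ^ 6 * X 1 ^ 5 * X 4 + X 1 + X 1 * X 2 ^ 3 + X 1 ^ 5 * X 3 ^ 7,
        X 4 ^ 2 + X 0 ^ 6 * X 2 ^ 5 * X 4 + X 2 * X 1 ^ 3 + X 2 + X 2 ^ 5 * X 3 ^ 7,
        X 4 ^ 2 + X 0 ^ 6 * X 3 ^ 5 * X 4 + X 3 * X 1 ^ 3 + X 3 * X 2 ^ 3 + X 3 ^ 5,
        1 + X 0 ^ 6 * X 4 ^ 5 + X 4 * X 1 ^ 3 + X 4 * X 2 ^ 3 + X 3 ^ 7 * X 4 ^ 5] : Fin 5 → MvPolynomial (Fin 5) k) 0}) (X j))).map E.toRingHom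
  haveI hQ : Q.IsPrime := Ideal.map_isPrime_of_equiv E
  have hcomap : Q.comap E.toRingHom = Ideal.span (Set.range fun j : Fin 5 => Ideal.Quotient.mk (Ideal.span {(![X 4 ^ 2 + X 0 ^ 5 * X 4 + X 0 * X 1 ^ 3 + X 0 * X 2 ^ 3 + X 0 ^ 5 * X 3 ^ 7,
        X 4 ^ 2 + X 0 ^ 6 * X 1 ^ 5 * X 4 + X 1 + X 1 * X 2 ^ 3 + X 1 ^ 5 * X 3 ^ 7,
        X 4 ^ 2 + X 0 ^ 6 * X 2 ^ 5 * X 4 + X 2 * X 1 ^ 3 + X 2 + X 2 ^ 5 * X 3 ^ 7,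
        X 4 ^ 2 + X 0 ^ 6 * X 3 ^ 5 * X 4 + X 3 * X 1 ^ 3 + X 3 * X 2 ^ 3 + X 3 ^ 5,
        1 + X 0 ^ 6 * X 4 ^ 5 + X 4 * X 1 ^ 3 + X 4 * X 2 ^ 3 + X 3 ^ 7 * X 4 ^ 5] : Fin 5 → MvPolynomial (Fin 5) k) 0}) (X j)) :=
    Ideal.comap_map_of_bijective E.toRingHom E.bijective
  haveI : (Q.comap E.toRingHom).IsPrime := Ideal.IsPrime.comap _
  -- `x̄/1 ∈ Q`
  have hxQ : algebraMap (MvPolynomial (Fin 5) k ⧸ Ideal.span {f}) _ (Ideal.Quotient.mk (Ideal.span {f}) (X 0)) ∈ Q := by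
    rw [← hE]; exact Ideal.mem_map_of_mem _ (Ideal.subset_span ⟨0, rfl⟩)
  -- `¬ FullCl 2` at `Q`: the origin of `k[X]/(g_x)` is not FULL (Fedder), and its local ring is that of `Q`
  have hbad : ¬ FullCl 2 (Localization.AtPrime Q) := by
    intro hfull
    obtain ⟨eQ⟩ := E8Char5FiModel.nonempty_ringEquiv_localization_comap E Q
    let w : Spec (.of (MvPolynomial (Fin 5) k ⧸ Ideal.span {(![X 4 ^ 2 + X 0 ^ 5 * X 4 + X 0 * X 1 ^ 3 + X 0 * X 2 ^ 3 + X 0 ^ 5 * X 3 ^ 7,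
        X 4 ^ 2 + X 0 ^ 6 * X 1 ^ 5 * X 4 + X 1 + X 1 * X 2 ^ 3 + X 1 ^ 5 * X 3 ^ 7,
        X 4 ^ 2 + X 0 ^ 6 * X 2 ^ 5 * X 4 + X 2 * X 1 ^ 3 + X 2 + X 2 ^ 5 * X 3 ^ 7,
        X 4 ^ 2 + X 0 ^ 6 * X 3 ^ 5 * X 4 + X 3 * X 1 ^ 3 + X 3 * X 2 ^ 3 + X 3 ^ 5,
        1 + X 0 ^ 6 * X 4 ^ 5 + X 4 * X 1 ^ 3 + X 4 * X 2 ^ 3 + X 3 ^ 7 * X 4 ^ 5] : Fin 5 → MvPolynomial (Fin 5) k) 0})) := ⟨Q.comap E.toRingHom, inferInstance⟩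
    have hw := HypersurfaceOriginNotFull.not_fullCl_stalk_origin_of_fedder_mem 2 k _ (g_ne_zero k 0) (constantCoeff_g_zero k)
      (g_zero_mem_bracket k) w hcomap
    exact hw (WFixAtNonClosedDimTwo.fullCl_of_ringEquiv 2 (eQ.symm.trans (Spec.stalkIso (.of _) w).commRingCatIsoToRingEquiv.symm) hfull)
  obtain ⟨b, hb, hbadb⟩ := TauFloorInputNotFull.exists_point_over_centre_not_fullCl _ _ hx0 2 Q hxQ hbad
  refine ⟨b, ?_, hbadb⟩
  haveI hvmax : v.asIdeal.IsMaximal := by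
    rw [hv]; exact DoublePointFermatCubicGerm.isMaximal_origin k f (Lx6q7Specimen.constantCoeff_f k f hf)
  have h1 : v.asIdeal ≤ ((affineBlowup.π _).base b).asIdeal := by rw [hv]; exact hb
  exact (PrimeSpectrum.ext (hvmax.eq_of_le ((affineBlowup.π _).base b).2.ne_top h1)).symm

end Summit.ResolutionOfSingularities.ResolutionOfSingularities.Theorems.FInjectiveMacaulayfication.Lx6q7PointFloorCharts

end
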